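import Literature.NumberTheory.Automorphic.SiegelReducedFamiliesSchur
import Mathlib.Analysis.Convex.Combination
import HarnessLib

/-!
# The Hull Lemma for Siegel-reduced families

Topic `NumberTheory/Automorphic`; namespace `Literature.NumberTheory.Automorphic`, grouping
sub-namespace `SiegelFamily`.  Third of three files (theorems only).

For `n ≥ 3` the image `𝔖 • 1` of a Siegel set in the cone of positive forms is not convex (the
pivot-ratio condition fails convexity: `H = [[1, ±1, 0], [±1, 1.9, 0], [0, 0, z]]`), but its
CONVEX HULL is again contained in a Siegel domain with larger constants.  In the recursive
vocabulary of `SiegelFamily.IsReduced`: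

* `SiegelFamily.isReduced_sum_add_aux` — for all `m` and `c, C, τ, η ≥ 0` there are `c', C', τ'`
  such that every finite convex combination `Σ wtᵢ Gᵢ` of `(c, C, τ)`-reduced families plus a
  positive semidefinite Hermitian family `E` with `E_w ≤ η (Σ wtᵢ a_{w,i}) · 1` (`a_{w,i}` the
  last pivots) is `(c', C', τ')`-reduced;
* `SiegelFamily.convexHull_isReduced_subset` — **the Hull Lemma**: the convex hull of the
  `(c, C, τ)`-reduced families lies in the `(c', C', τ')`-reduced families.

Proof (induction on `m`, peeling the last index): the last pivot and last column of
`H = Σ wtᵢ Gᵢ + E` are controlled by the weighted means; the Schur complement of `H` is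
`Σ wtᵢ schur(Gᵢ) + E'` with `0 ≤ E' ≤ (η + m c²) A · 1` (`qf_schur_sum_sub_bounds`); since
`aᵢ < τ · (next pivot)` one has `A ≤ τ · (Σ wtᵢ · next pivots)` and the induction hypothesis
applies to `(schur Gᵢ, E', η' = τ (η + m c²))`.  Constants: `c' = max (c + η + 1) c₁`,
`C' = max ((1 + η) C + 1) C₁`, `τ' = max ((1 + η) τ + 1) τ₁`.

## References

* A. Borel, *Introduction aux groupes arithmétiques*, Hermann (1969), §1, §12–§13 [Borel1969].
* R. A. Horn, C. R. Johnson, *Matrix Analysis*, 2nd ed. (2013), §7.7 — standard. [folklore]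
-/

noncomputable section

open scoped ComplexOrder Matrix ComplexConjugate
open Finset

namespace Literature.NumberTheory.Automorphic

namespace SiegelFamily

/-! ### The Hull Lemma -/

section Hull

/-- **Weighted sums of reduced families with positive semidefinite slack are reduced** (the
inductive form of the Hull Lemma): for `c, C, τ, η ≥ 0` there are `c', C', τ'` such that for all
finite convex combinations `Σ wtᵢ Gᵢ` of `(c, C, τ)`-reduced families and all positive
semidefinite Hermitian families `E` with `E_w ≤ η (Σ wtᵢ a_{w,i}) · 1` (`a_{w,i}` the last
pivots of `Gᵢ`), the family `Σ wtᵢ Gᵢ + E` is `(c', C', τ')`-reduced. [folklore] -/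
theorem isReduced_sum_add_aux {ι : Type*} :
    ∀ (m : ℕ) (c C τ η : ℝ), 0 ≤ c → 0 ≤ C → 0 ≤ τ → 0 ≤ η →
    ∃ c' C' τ' : ℝ, ∀ {σ : Type*} (s : Finset σ) (wt : σ → ℝ)
      (G : σ → ι → Matrix (Fin m) (Fin m) ℂ) (E : ι → Matrix (Fin m) (Fin m) ℂ),
      (∀ i ∈ s, 0 ≤ wt i) → ∑ i ∈ s, wt i = 1 → (∀ i ∈ s, IsReduced c C τ m (G i)) →
      (∀ w, (E w).PosSemidef) →
      (∀ w, ((η * ∑ i ∈ s, wt i * lastRe (G i w)) • (1 : Matrix (Fin m) (Fin m) ℂ) -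
        E w).PosSemidef) →
      IsReduced c' C' τ' m (fun w => ∑ i ∈ s, wt i • G i w + E w)
  | 0, _, _, _, _, _, _, _, _ => ⟨0, 0, 0, fun _ _ _ _ _ _ _ _ _ => trivial⟩
  | m + 1, c, C, τ, η, hc, hC, hτ, hη => by
    classical
    obtain ⟨c₁, C₁, τ₁, IH⟩ :=
      isReduced_sum_add_aux m c C τ (τ * (η + m * c ^ 2)) hc hC hτ (by positivity)
    refine ⟨max (c + η + 1) c₁, max ((1 + η) * C + 1) C₁, max ((1 + η) * τ + 1) τ₁, ?_⟩
    intro σ s wt G E hwt hsum hG hE hEb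
    -- notation and unpacking
    set l : Fin (m + 1) := Fin.last m with hl
    have hGh : ∀ i ∈ s, ∀ w, (G i w).IsHermitian := fun i hi w => (hG i hi).1 w
    have hGpos : ∀ i ∈ s, ∀ w, 0 < (G i w l l).re := fun i hi => (hG i hi).2.1
    have hGcross : ∀ i ∈ s, ∀ w w', (G i w l l).re < C * (G i w' l l).re :=
      fun i hi => (hG i hi).2.2.1
    have hGcol : ∀ i ∈ s, ∀ w (j : Fin m), ‖G i w j.castSucc l‖ < c * (G i w l l).re :=
      fun i hi => (hG i hi).2.2.2.1
    have hGratio : ∀ i ∈ s, ∀ w (j : Fin m), (j : ℕ) + 1 = m →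
        (G i w l l).re < τ * (schur (G i) w j j).re := fun i hi => (hG i hi).2.2.2.2.1
    have hGsch : ∀ i ∈ s, IsReduced c C τ m (schur (G i)) := fun i hi => (hG i hi).2.2.2.2.2
    -- a positive weight
    obtain ⟨i₀, hi₀, hwt0⟩ : ∃ i ∈ s, 0 < wt i := by
      obtain ⟨i, hi, hne⟩ := Finset.exists_ne_zero_of_sum_ne_zero
        (by rw [hsum]; exact one_ne_zero : ∑ i ∈ s, wt i ≠ 0)
      exact ⟨i, hi, lt_of_le_of_ne (hwt i hi) (Ne.symm hne)⟩
    -- `A w = Σ wtᵢ a_{i,w} > 0`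
    set A : ι → ℝ := fun w => ∑ i ∈ s, wt i * (G i w l l).re with hAdef
    have hA : ∀ w, 0 < A w := fun w => by
      have h1 : wt i₀ * (G i₀ w l l).re ≤ A w :=
        Finset.single_le_sum (f := fun i => wt i * (G i w l l).re)
          (fun i hi => mul_nonneg (hwt i hi) (hGpos i hi w).le) hi₀
      exact lt_of_lt_of_le (mul_pos hwt0 (hGpos i₀ hi₀ w)) h1
    have hEb' : ∀ w, ((η * A w) • (1 : Matrix (Fin (m + 1)) (Fin (m + 1)) ℂ) - E w).PosSemidef :=
      fun w => hEb w
    -- the sum `H`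
    set H : ι → Matrix (Fin (m + 1)) (Fin (m + 1)) ℂ := fun w => ∑ i ∈ s, wt i • G i w + E w
      with hHdef
    have hHh : ∀ w, (H w).IsHermitian := fun w =>
      isHermitian_sum_smul_add s wt (fun i => G i w) (E w) (fun i hi => hGh i hi w) (hE w).1
    have hcorner : ∀ w, (H w l l).re = A w + (E w l l).re := fun w =>
      re_sum_smul_add_apply s wt (fun i => G i w) (E w) l l
    have hEc : ∀ w, 0 ≤ (E w l l).re ∧ (E w l l).re ≤ η * A w :=
      fun w => corner_re_le (hE w) (hEb' w)
    have hHpos : ∀ w, 0 < (H w l l).re := fun w => by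
      rw [hcorner]; linarith [hA w, (hEc w).1]
    have hHle : ∀ w, (H w l l).re ≤ (1 + η) * A w := fun w => by
      rw [hcorner]; nlinarith [(hEc w).2, hA w]
    -- the slack of the Schur complement
    set E' : ι → Matrix (Fin m) (Fin m) ℂ := fun w => schur H w - ∑ i ∈ s, wt i • schur (G i) w
      with hE'def
    have hschurH : schur H = fun w => ∑ i ∈ s, wt i • schur (G i) w + E' w := by
      funext w; simp only [hE'def]; abel
    have hsumh : ∀ w, (∑ i ∈ s, wt i • schur (G i) w).IsHermitian := fun w => by
      have := isHermitian_sum_smul_add s wt (fun i => schur (G i) w) 0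
        (fun i hi => isHermitian_schur w (hGh i hi w)) Matrix.isHermitian_zero
      simpa using this
    have hE'h : ∀ w, (E' w).IsHermitian := fun w =>
      (isHermitian_schur w (hHh w)).sub (hsumh w)
    have hqE' : ∀ w y, qf (E' w) y = qf (schur H w) y - ∑ i ∈ s, wt i * qf (schur (G i) w) y := by
      intro w y
      simp only [hE'def, qf_sub, qf_sum, qf_smul]
    have hcore := fun w y => qf_schur_sum_sub_bounds s wt G E hwt hGh hGpos hGcol hE hEb' hA w y
    have hE'psd : ∀ w, (E' w).PosSemidef := fun w =>
      (posSemidef_iff_qf_nonneg (hE'h w)).2 fun y => by rw [hqE']; exact (hcore w y).1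
    -- the Loewner bound on `E'` needed by the induction hypothesis
    have hE'b : ∀ w, (((τ * (η + m * c ^ 2)) * ∑ i ∈ s, wt i * lastRe (schur (G i) w)) •
        (1 : Matrix (Fin m) (Fin m) ℂ) - E' w).PosSemidef := by
      intro w
      rcases Nat.eq_zero_or_pos m with hm | hm
      · subst hm
        exact posSemidef_fin_zero _
      · obtain ⟨k, rfl⟩ := Nat.exists_eq_succ_of_ne_zero hm.ne'
        -- `A w ≤ τ Σ wtᵢ (next pivot)`
        set S : ℝ := ∑ i ∈ s, wt i * lastRe (schur (G i) w) with hSdef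
        have hAS : A w ≤ τ * S := by
          rw [hSdef, Finset.mul_sum]
          refine Finset.sum_le_sum fun i hi => ?_
          have h := hGratio i hi w (Fin.last k) (by simp)
          rw [lastRe_succ]
          nlinarith [h, hwt i hi]
        rw [posSemidef_smul_one_sub_iff (hE'h w)]
        intro y
        have h2 := (hcore w y).2
        rw [← hqE'] at h2
        have hZ : 0 ≤ ∑ j, ‖y j‖ ^ 2 := Finset.sum_nonneg fun j _ => sq_nonneg _
        have hηm : 0 ≤ η + ↑(k + 1) * c ^ 2 := by positivity
        calc qf (E' w) y ≤ (η + ↑(k + 1) * c ^ 2) * A w * ∑ j, ‖y j‖ ^ 2 := h2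
          _ ≤ (η + ↑(k + 1) * c ^ 2) * (τ * S) * ∑ j, ‖y j‖ ^ 2 :=
              mul_le_mul_of_nonneg_right (mul_le_mul_of_nonneg_left hAS hηm) hZ
          _ = τ * (η + ↑(k + 1) * c ^ 2) * S * ∑ j, ‖y j‖ ^ 2 := by ring
    -- induction hypothesis: the Schur complement family is reduced
    have hIH : IsReduced c₁ C₁ τ₁ m (schur H) := by
      rw [hschurH]
      exact IH s wt (fun i => schur (G i)) E' hwt hsum hGsch hE'psd hE'b
    -- entries of `schur H`
    have hschur_re : ∀ w (j : Fin m), (schur H w j j).re =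
        ∑ i ∈ s, wt i * (schur (G i) w j j).re + (E' w j j).re := fun w j => by
      rw [hschurH]
      exact re_sum_smul_add_apply s wt (fun i => schur (G i) w) (E' w) j j
    -- the six clauses
    rw [isReduced_succ_iff]
    refine ⟨hHh, hHpos, ?_, ?_, ?_, hIH.mono (le_max_right _ _) (le_max_right _ _) (le_max_right _ _)⟩
    · -- comparability across the index set
      intro w w'
      have h1 : A w ≤ C * A w' := by
        simp only [hAdef]
        rw [Finset.mul_sum]
        refine Finset.sum_le_sum fun i hi => ?_
        nlinarith [hGcross i hi w w', hwt i hi, (hGpos i hi w').le]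
      have hpos' : 0 < A w' + (E w' l l).re := by linarith [hA w', (hEc w').1]
      calc (H w l l).re ≤ (1 + η) * A w := hHle w
        _ ≤ (1 + η) * (C * A w') := mul_le_mul_of_nonneg_left h1 (by linarith)
        _ < ((1 + η) * C + 1) * (A w' + (E w' l l).re) := by
            nlinarith [hA w', (hEc w').1, mul_nonneg (by linarith : (0:ℝ) ≤ 1 + η) hC]
        _ ≤ max ((1 + η) * C + 1) C₁ * (H w' l l).re := by
            rw [hcorner w']
            exact mul_le_mul_of_nonneg_right (le_max_left _ _) hpos'.le
    · -- the last column
      intro w j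
      have hnorm : ‖H w j.castSucc l‖ ≤ ∑ i ∈ s, wt i * ‖G i w j.castSucc l‖ + ‖E w j.castSucc l‖ := by
        rw [hHdef]
        simp only
        rw [sum_smul_add_apply]
        refine (norm_add_le _ _).trans ?_
        gcongr
        refine (norm_sum_le _ _).trans (le_of_eq (Finset.sum_congr rfl fun i hi => ?_))
        rw [norm_mul, Complex.norm_real, Real.norm_of_nonneg (hwt i hi)]
      have h1 : ∑ i ∈ s, wt i * ‖G i w j.castSucc l‖ ≤ c * A w := by
        simp only [hAdef]
        rw [Finset.mul_sum]
        refine Finset.sum_le_sum fun i hi => ?_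
        nlinarith [hGcol i hi w j, hwt i hi]
      have h2 : ‖E w j.castSucc l‖ ≤ η * A w := norm_lastCol_le (hE w) (hEb' w) j
      have hpos' : 0 < A w + (E w l l).re := by linarith [hA w, (hEc w).1]
      calc ‖H w j.castSucc l‖ ≤ (c + η) * A w := by linarith [hnorm, h1, h2]
        _ < (c + η + 1) * (A w + (E w l l).re) := by
            nlinarith [hA w, (hEc w).1, mul_nonneg (by linarith : (0:ℝ) ≤ c + η) (hEc w).1]
        _ ≤ max (c + η + 1) c₁ * (H w l l).re := by
            rw [hcorner w]
            exact mul_le_mul_of_nonneg_right (le_max_left _ _) hpos'.le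
    · -- the pivot ratio
      intro w j hj
      set S : ℝ := ∑ i ∈ s, wt i * (schur (G i) w j j).re with hSdef
      have hAS : A w ≤ τ * S := by
        rw [hSdef, Finset.mul_sum]
        refine Finset.sum_le_sum fun i hi => ?_
        nlinarith [hGratio i hi w j hj, hwt i hi]
      have hs0 : 0 < (schur (G i₀) w j j).re := by
        have h := hGratio i₀ hi₀ w j hj
        have ha := hGpos i₀ hi₀ w
        by_contra hle
        push Not at hle
        nlinarith [mul_nonpos_iff.2 (Or.inl ⟨hτ, hle⟩)]
      have hS : 0 < S := by
        have h1 : wt i₀ * (schur (G i₀) w j j).re ≤ S :=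
          Finset.single_le_sum (f := fun i => wt i * (schur (G i) w j j).re)
            (fun i hi => by
              have h := hGratio i hi w j hj
              have ha := hGpos i hi w
              have : 0 ≤ (schur (G i) w j j).re := by
                by_contra hle
                push Not at hle
                nlinarith [mul_nonpos_iff.2 (Or.inl ⟨hτ, hle.le⟩)]
              exact mul_nonneg (hwt i hi) this) hi₀
        exact lt_of_lt_of_le (mul_pos hwt0 hs0) h1
      have hE'jj : 0 ≤ (E' w j j).re :=
        (Complex.nonneg_iff.1 ((hE'psd w).diag_nonneg (i := j))).1
      have hSle : S ≤ (schur H w j j).re := by rw [hschur_re]; linarith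
      calc (H w l l).re ≤ (1 + η) * A w := hHle w
        _ ≤ (1 + η) * (τ * S) := mul_le_mul_of_nonneg_left hAS (by linarith)
        _ < ((1 + η) * τ + 1) * S := by nlinarith [mul_nonneg (by linarith : (0:ℝ) ≤ 1 + η) hτ]
        _ ≤ ((1 + η) * τ + 1) * (schur H w j j).re :=
            mul_le_mul_of_nonneg_left hSle (by nlinarith [mul_nonneg (by linarith : (0:ℝ) ≤ 1 + η) hτ])
        _ ≤ max ((1 + η) * τ + 1) τ₁ * (schur H w j j).re :=
            mul_le_mul_of_nonneg_right (le_max_left _ _) (hS.le.trans hSle)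

/-- **The Hull Lemma for Siegel-reduced families.**  For all `m, c, C, τ` there are constants
`c', C', τ'` such that the convex hull of the `(c, C, τ)`-reduced families of `m × m` Hermitian
matrices is contained in the `(c', C', τ')`-reduced families: the convex hull of a Siegel domain
of the cone of positive forms lies in a Siegel domain. [folklore] -/
theorem convexHull_isReduced_subset {ι : Type*} (m : ℕ) (c C τ : ℝ) :
    ∃ c' C' τ' : ℝ, convexHull ℝ {H : ι → Matrix (Fin m) (Fin m) ℂ | IsReduced c C τ m H} ⊆
      {H | IsReduced c' C' τ' m H} := by
  classical
  obtain ⟨c', C', τ', h⟩ := isReduced_sum_add_aux (ι := ι) m |c| |C| |τ| 0 (abs_nonneg c)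
    (abs_nonneg C) (abs_nonneg τ) le_rfl
  refine ⟨c', C', τ', fun H hH => ?_⟩
  rw [_root_.convexHull_eq] at hH
  obtain ⟨κ, t, w, z, hw0, hw1, hz, rfl⟩ := hH
  rw [Finset.centerMass_eq_of_sum_1 _ _ hw1]
  have h1 := h t w z 0 hw0 hw1
    (fun i hi => (hz i hi).mono (le_abs_self c) (le_abs_self C) (le_abs_self τ))
    (fun _ => Matrix.PosSemidef.zero) (fun _ => by simpa using Matrix.PosSemidef.zero)
  have he : (fun x => ∑ i ∈ t, w i • z i x + (0 : ι → Matrix (Fin m) (Fin m) ℂ) x) =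
      ∑ i ∈ t, w i • z i := by
    funext x
    simp [Finset.sum_apply]
  rw [he] at h1
  exact h1

end Hull


end SiegelFamily

end Literature.NumberTheory.Automorphic
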